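import Summits.BirchSwinnertonDyer.BirchSwinnertonDyer.Theorems.RamifiedHeegnerPairRamifiedPairUpperBoundOfUpperHalfOverK
import HarnessLib


-- D-0017: single-problem summit, so `Summit.BirchSwinnertonDyer.BirchSwinnertonDyer.…` repeats a namespace BY DESIGN.
set_option linter.dupNamespace false

noncomputable section

open scoped Classical


/-! BC3 skeleton **v4** (lead prover bsd-line-rhp-p2 g2, 2026-08-28) for `RamifiedPairUpperBound` (crux X2,
stmt-BirchSwinnertonDyer-23192), line `birth`, RESHAPED from v3's single over-`K` stub into the three MEMBER
statements over `ℚ` that the crux is the sum of (door (ii) of the landed file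
`Theorems/RamifiedHeegnerPairRamifiedPairUpperBoundOfUpperHalfOverK.lean`, lead g0, p601388; refined by rank in
`Theorems/RamifiedHeegnerPairRamifiedPairUpperBoundRankOneMember.lean`, lead g2, p606327). WHY THE RESHAPE
(lead's audit `Cruxes/RamifiedPairUpperBound/X2-ENGINE-AUDIT.md`): X2 is, pair by pair, LITERALLY the cell's
joint upper half `SchneiderFree.Upper.JointUpperBoundAt W V 3` over the 3-RAMIFIED pair
(`ramifiedPairUpperBound_iff_forall_jointUpperBoundAt`, `Iff.rfl`); for the UPPER half Kolyvagin needs no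
hypothesis at `p` (`Kolyvagin1990_padicValNat_card_sha_le`: `p` odd, `ρ̄` onto; `c₃(E) ∈ {1,2,4}` on Gss2), so a
SPLIT Heegner field gives the same index bound as the thesis's ramified `ℚ(√d)` with PRINTED objects, and in
either field the bound is Tamagawa-exact only through `2·ord₃ ∏_ℓ c_ℓ(E)` (census: 346 of the 355 residual
rank-one Gss2 classes carry a Tamagawa `3` at some `ℓ ≠ 3`); the over-`K` CM-point engine of v1–v3 (CST `X_U` at
joint ramification, Nekovář 2007 made 3-exact) is therefore dominated for X2 — it needs untyped objects and two
extra non-print steps for no gain — and the 3-ramified field stays load-bearing for X1 only. The composition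
below needs NO published input (v3's `stub_publishedInputs` is gone): the three stubs are

* `stub_leafRankOneUpper` — THE OPEN CORE (research): the Euler-system half `ord₃ #Ш(E) ≤ ord₃ #Ш_an(E)` for
  every non-CM Gss2-at-3 curve of analytic rank ONE. Road of record (RankOneMember §§2–4): over a SPLIT Heegner
  field `K′` (Friedberg–Hoffstein supply, 3 split), the cell's Kolyvagin-side socket
  `SchneiderFree.Upper.IndexUpperBoundLeAt W 3 K′ P (v₃ c)` (= Jetchev's Σ-form divisibility of the derived
  Heegner classes at `p = 3`, `9 ∣ N`: the tree's `AdditiveThree.RKC3Divisibility`, unproved; PRINT =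
  Kolyvagin's bound on the 9 tam-free classes) + the LOWER half `Typed.MissingLowerBoundAt Wd 3` of the
  rank-ZERO twist `Wd ≅ E^{(d_{K′})}` (again Gss2 at 3 — X1's rank-zero member content) ⟹ this stub, row by row.
* `stub_leafRankZeroUpper` — the same half for the rank-ZERO Gss2 curves: PRINT on the Kato-sharp rows (Kato 2004
  Thm. 14.5 (3) at an additive potentially good `3`: `ρ_{E,3^∞}` onto, `3 ∤ ∏_ℓ c_ℓ(E)`, `3 ∤ c_D`; companion
  file RankZeroMember, p602105); open off those rows (census r0: 368 onto ∧ `3 ∤ ∏c`, 284 onto ∧ `3 ∣ ∏c`,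
  53 normaliser image).
* `stub_goodSSUpper` — the same half for the non-CM GOOD-supersingular-at-3 partners with `r_an ≤ 1`: PRINT on the
  `surj(9)` rows (rank 0: Perrin-Riou 2003 Prop. 4.8; rank 1: Kobayashi 2013 after Cor. 1.3); open off them.
  (Inside the route this member's full `BSD₃` is the residual `GoodSupersingularAtThree`; as a stub of X2 it
  is the upper half only.)

History: v1 (planner pss3 g9; `stub_kolyvaginUpperOverK`, `stub_shaDescentOdd`) → v2/v3 (lead g0: bookkeeping
discharged, ONE over-`K` core `stub_upperHalfOverK` ≡ X2 mod PUB, lossless by p601388 (i)+(i′)) → v4 (this: the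
core cut by member and rank; `RamifiedPairUpperBound_of` = door (ii) with the rank split, kernel-checked, no
`sorry` outside the three stubs). -/

namespace Summit.BirchSwinnertonDyer.BirchSwinnertonDyer.Cruxes.RamifiedPairUpperBound.Birth

open WeierstrassCurve Literature Literature.NumberTheory.EllipticCurves
  Literature.NumberTheory.EllipticCurves.Rank1Residual
  Summit.BirchSwinnertonDyer.BirchSwinnertonDyer.Theses.RamifiedHeegnerPair
  Summit.BirchSwinnertonDyer.BirchSwinnertonDyer.Theorems

/-- STUB S1 (OPEN CORE; research): the Euler-system (upper) half of `BSD₃` over `ℚ` for every non-CM globally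
minimal curve additive of class `(G) ∧ ss` at `3` with analytic rank ONE: `#Ш_an(W)` is a rational `q` with
`ord₃ #Ш(W) ≤ ord₃ q`. Road of record: split-field Kolyvagin socket (Tamagawa-exact = RKC₃ divisibility) +
the rank-zero twist's lower half (RankOneMember §§2–4). -/
theorem stub_leafRankOneUpper :
    ∀ (W : WeierstrassCurve ℚ) [W.IsElliptic] [W.IsGloballyMinimal],
      ¬ W.HasCM → Literature.NumberTheory.EllipticCurves.Rank1Residual.Addv W 3 →
      Summit.BirchSwinnertonDyer.Rank1Residual.Additive.SubGss W 3 → W.analyticRank = 1 →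
      Literature.NumberTheory.EllipticCurves.Rank1Residual.Typed.MissingUpperBoundAt W 3 := by
  sorry

/-- STUB S0 (PRINT on the Kato-sharp rows, open off them): the same half for the rank-ZERO curves of the leaf
(Kato 2004 Thm. 14.5 (3) at an additive potentially good `3` on the rows `ρ_{E,3^∞}` onto, `3 ∤ ∏_ℓ c_ℓ(E)`,
`3 ∤ c_D` — `X4RankZero.missingUpperBoundAt_of_kato`, companion file RankZeroMember). -/
theorem stub_leafRankZeroUpper :
    ∀ (W : WeierstrassCurve ℚ) [W.IsElliptic] [W.IsGloballyMinimal],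
      ¬ W.HasCM → Literature.NumberTheory.EllipticCurves.Rank1Residual.Addv W 3 →
      Summit.BirchSwinnertonDyer.Rank1Residual.Additive.SubGss W 3 → W.analyticRank = 0 →
      Literature.NumberTheory.EllipticCurves.Rank1Residual.Typed.MissingUpperBoundAt W 3 := by
  sorry

/-- STUB SV (PRINT on the `surj(9)` rows, open off them): the same half for every non-CM globally minimal curve
with GOOD supersingular reduction at `3` and analytic rank `≤ 1` (rank 0: Perrin-Riou 2003 Prop. 4.8 =
`PerrinRiou2003.missingUpperBoundAt_three_of_prop48_of_nine`; rank 1: Kobayashi 2013 =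
`Kobayashi2013.missingUpperBoundAt_three_of_rem13_of_nine`). -/
theorem stub_goodSSUpper :
    ∀ (V : WeierstrassCurve ℚ) [V.IsElliptic] [V.IsGloballyMinimal],
      ¬ V.HasCM → Literature.NumberTheory.EllipticCurves.Rank1Residual.GoodSS V 3 → V.analyticRank ≤ 1 →
      Literature.NumberTheory.EllipticCurves.Rank1Residual.Typed.MissingUpperBoundAt V 3 := by
  sorry

/-- The kernel-checked composition BY NAME: the three member stubs give the route crux `RamifiedPairUpperBound`
(type literally the route decl) — door (ii) `RamifiedPairUpperBound.ramifiedPairUpperBound_of_missingUpperBoundAt`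
with the leaf member split by analytic rank (`r_an ≤ 1` ⟺ `r_an = 0 ∨ r_an = 1`). No published input is used.
[cite: Miller2011LMS, §1 and Def. 1.1] -/
theorem RamifiedPairUpperBound_of
    (h1 : ∀ (W : WeierstrassCurve ℚ) [W.IsElliptic] [W.IsGloballyMinimal],
      ¬ W.HasCM → Literature.NumberTheory.EllipticCurves.Rank1Residual.Addv W 3 →
      Summit.BirchSwinnertonDyer.Rank1Residual.Additive.SubGss W 3 → W.analyticRank = 1 →
      Literature.NumberTheory.EllipticCurves.Rank1Residual.Typed.MissingUpperBoundAt W 3)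
    (h0 : ∀ (W : WeierstrassCurve ℚ) [W.IsElliptic] [W.IsGloballyMinimal],
      ¬ W.HasCM → Literature.NumberTheory.EllipticCurves.Rank1Residual.Addv W 3 →
      Summit.BirchSwinnertonDyer.Rank1Residual.Additive.SubGss W 3 → W.analyticRank = 0 →
      Literature.NumberTheory.EllipticCurves.Rank1Residual.Typed.MissingUpperBoundAt W 3)
    (hV : ∀ (V : WeierstrassCurve ℚ) [V.IsElliptic] [V.IsGloballyMinimal],
      ¬ V.HasCM → Literature.NumberTheory.EllipticCurves.Rank1Residual.GoodSS V 3 → V.analyticRank ≤ 1 →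
      Literature.NumberTheory.EllipticCurves.Rank1Residual.Typed.MissingUpperBoundAt V 3) :
    Summit.BirchSwinnertonDyer.BirchSwinnertonDyer.Theses.RamifiedHeegnerPair.RamifiedPairUpperBound :=
  RamifiedPairUpperBound.ramifiedPairUpperBound_of_missingUpperBoundAt
    (fun W _ _ hCM hadd hsub hr ↦ by
      rcases Nat.le_one_iff_eq_zero_or_eq_one.mp hr with h | h
      · exact h0 W hCM hadd hsub h
      · exact h1 W hCM hadd hsub h)
    hV

/-- The crux from the (sorried) stubs — shows the skeleton is complete. -/
theorem RamifiedPairUpperBound_holds_of_stubs :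
    Summit.BirchSwinnertonDyer.BirchSwinnertonDyer.Theses.RamifiedHeegnerPair.RamifiedPairUpperBound :=
  RamifiedPairUpperBound_of stub_leafRankOneUpper stub_leafRankZeroUpper stub_goodSSUpper

end Summit.BirchSwinnertonDyer.BirchSwinnertonDyer.Cruxes.RamifiedPairUpperBound.Birth

end
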